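import Mathlib.AlgebraicTopology.AlternatingFaceMapComplex
import Mathlib.AlgebraicTopology.SingularSet
import Mathlib.CategoryTheory.Abelian.Ext
import Mathlib.Algebra.Homology.ShortComplex.ModuleCat
import Mathlib.Algebra.Homology.ConcreteCategory
import Mathlib.Topology.Homotopy.Equiv
import Literature.AlgebraicTopology.SingularHomology.SingularChains
import HarnessLib

-- provenance: harness21/H21/H21/Prelude/AlgTop/SingularCochains.lean @ 12e2ffd (interim HEAD d8f2665); M5 mechanical rewrite
/-!
# Singular cochains and singular cohomology (trunk G04 AlgTop, item C5 `SingularCochains`)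

Singular cochains of a topological space `X` with coefficients in an `R`-module `M`, modelled as
honest functions `SingularSimplex X n → M` (Hatcher, *Algebraic Topology* (2002), §3.1), exactly as
Mathlib models group cohomology by inhomogeneous cochains
(`groupCohomology.inhomogeneousCochains`, whose API block `cocycles` / `cocyclesMk` / `iCocycles` /
`π` / `groupCohomology_induction_on` we imitate here — it is a *pattern*, not an import).

Categorically, `n ↦ (SingularSimplex X n → M)` is a cosimplicial `R`-module
(`Literature.AlgebraicTopology.SingularHomology.singularCochainCosimplicial`, precomposition with the simplicial structure of the singular
simplicial set `TopCat.toSSet.obj (TopCat.of X)`), and the singular cochain complex is Mathlib's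
`AlgebraicTopology.alternatingCofaceMapComplex` applied to it, so that `d ∘ d = 0` and
contravariant functoriality come for free. Mathlib has no singular cohomology as such (searched:
`singularCohomology`, `Cochain`, `linearYonedaObj`); the abstract dual complex
`(singularChainComplex R R X).linearYonedaObj R (ModuleCat.of R (ULift M))`
(`ChainComplex.linearYonedaObj`) is related to ours by the levelwise explicit isomorphism
`singularCochainComplex.XIso` and the stated comparison `nonempty_iso_linearYonedaObj`.

Conventions (see `Literature.Prelude.AlgTop.SingularChains`): `X : Type u` unbundled, `R : Type v` a
commutative ring, `M : Type v` an `R`-module, all objects in `ModuleCat.{max u v} R`; everything is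
generic in `R`.

## Main definitions

* `Literature.singularCochainCosimplicial R M X`: the cosimplicial module `⦋n⦌ ↦ (SingularSimplex X n → M)`.
* `Literature.singularCochainComplex R M X`: the singular cochain complex `C^•(X; M)`, with `d_apply`
  (the coboundary formula), `cocycles`, `cocyclesMk`, `iCocycles`, `toCocycles`, the pull-back
  `singularCochainComplex.map f : C^•(Y; M) ⟶ C^•(X; M)` and `XIso`.
* `Literature.singularCohomology R M X n`: `Hⁿ(X; M)`, with `π`, `singularCohomology_induction_on`, `map`,
  `map_id`, `map_comp`, `map_eq_of_homotopic`, `mapIso`, `isoOfHomotopyEquiv`.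

## References

* A. Hatcher, *Algebraic Topology*, CUP 2002, §2.1 and §3.1.
-/

noncomputable section

open CategoryTheory Limits AlgebraicTopology Simplicial Opposite

universe u v

namespace Literature.AlgebraicTopology.SingularHomology

variable (R : Type v) [CommRing R] (M : Type v) [AddCommGroup M] [Module R M]
variable {X Y Z : Type u} [TopologicalSpace X] [TopologicalSpace Y] [TopologicalSpace Z]

/-! ### The cosimplicial module of cochains -/

variable (X) in
/-- The cosimplicial `R`-module `⦋n⦌ ↦ (SingularSimplex X n → M)` of `M`-valued functions on the
singular simplicial set of `X`, with cosimplicial structure given by precomposition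
(Hatcher 2002, §3.1, "cochains are functions on simplices"). [cite: Hatcher2002, §3.1  "cochains are functions on simplic] -/
def singularCochainCosimplicial : CosimplicialObject (ModuleCat.{max u v} R) where
  obj d := ModuleCat.of R ((TopCat.toSSet.obj (TopCat.of X)).obj (op d) → M)
  map f := ModuleCat.ofHom (LinearMap.funLeft R M ((TopCat.toSSet.obj (TopCat.of X)).map f.op))
  map_id d := by ext; simp
  map_comp f g := by ext; simp

namespace singularCochainCosimplicial

/-- The morphism of cosimplicial modules `C^•(Y; M) ⟶ C^•(X; M)` induced by a continuous map
`f : X → Y`, precomposition with `σ ↦ f ∘ σ` (Hatcher 2002, §3.1, induced homomorphism `f^♯`). [cite: Hatcher2002, §3.1  induced homomorphism  f^♯] -/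
def map (f : C(X, Y)) :
    singularCochainCosimplicial R M Y ⟶ singularCochainCosimplicial R M X where
  app d := ModuleCat.ofHom
    (LinearMap.funLeft R M ((TopCat.toSSet.map (TopCat.ofHom f)).app (op d)))
  naturality d e g := by
    ext φ
    funext σ
    change φ ((TopCat.toSSet.obj (TopCat.of Y)).map g.op
      ((TopCat.toSSet.map (TopCat.ofHom f)).app (op e) σ)) =
      φ ((TopCat.toSSet.map (TopCat.ofHom f)).app (op d)
        ((TopCat.toSSet.obj (TopCat.of X)).map g.op σ))
    rw [← NatTrans.naturality_apply]

end singularCochainCosimplicial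

/-! ### The singular cochain complex -/

variable (X) in
/-- The singular cochain complex `C^•(X; M)` with coefficients in the `R`-module `M`, an object of
`CochainComplex (ModuleCat.{max u v} R) ℕ` (Hatcher 2002, §3.1): the alternating coface map complex
of `singularCochainCosimplicial R M X`. Its `n`-cochains are functions `SingularSimplex X n → M`. [cite: Hatcher2002, §3.1] -/
def singularCochainComplex : CochainComplex (ModuleCat.{max u v} R) ℕ :=
  (alternatingCofaceMapComplex _).obj (singularCochainCosimplicial R M X)

namespace singularCochainComplex

variable {R M} {n : ℕ}

/-- Two singular cochains are equal if they agree on every singular simplex (cochains are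
functions; Hatcher 2002, §3.1). [cite: Hatcher2002, §3.1] -/
@[ext]
lemma ext {φ ψ : (singularCochainComplex R M X).X n}
    (h : ∀ σ : SingularSimplex X n, φ σ = ψ σ) : φ = ψ :=
  funext h

/-- The singular coboundary formula `(δφ)(σ) = ∑ᵢ (-1)ⁱ φ(σ ∘ δᵢ)` (Hatcher 2002, §3.1,
"δφ(σ) = Σ (-1)ⁱ φ(σ|[v₀,…,v̂ᵢ,…,vₙ₊₁])"). [cite: Hatcher2002, §3.1  "δφ(σ] -/
@[simp]
lemma d_apply (φ : SingularSimplex X n → M) (σ : SingularSimplex X (n + 1)) :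
    (singularCochainComplex R M X).d n (n + 1) φ σ =
      ∑ i : Fin (n + 2), ((-1 : R) ^ (i : ℕ)) • φ (σ.face i) := by
  have h : (singularCochainComplex R M X).d n (n + 1) =
      ∑ i : Fin (n + 2), (-1 : ℤ) ^ (i : ℕ) • (singularCochainCosimplicial R M X).δ i :=
    CochainComplex.of_d (fun k ↦ (singularCochainCosimplicial R M X).obj ⦋k⦌)
      (AlternatingCofaceMapComplex.objD _) n
  rw [h]
  change (ModuleCat.Hom.hom (∑ i : Fin (n + 2),
    (-1 : ℤ) ^ (i : ℕ) • (singularCochainCosimplicial R M X).δ i :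
      (singularCochainCosimplicial R M X).obj ⦋n⦌ ⟶
        (singularCochainCosimplicial R M X).obj ⦋n + 1⦌) φ) σ = _
  rw [ModuleCat.hom_sum, LinearMap.coe_sum, Finset.sum_apply]
  refine (Finset.sum_apply (M := fun _ ↦ M) σ Finset.univ _).trans
    (Finset.sum_congr rfl fun i _ ↦ ?_)
  change ((-1 : ℤ) ^ (i : ℕ)) • φ (σ.face i) = _
  rw [← Int.cast_smul_eq_zsmul R, Int.cast_pow, Int.cast_neg, Int.cast_one]

variable (R M X n) in
/-- The singular `n`-cocycles `Zⁿ(X; M) = ker δ` (Hatcher 2002, §3.1). [cite: Hatcher2002, §3.1] -/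
abbrev cocycles : ModuleCat.{max u v} R := (singularCochainComplex R M X).cycles n

/-- Make an `n`-cocycle out of a cochain in the kernel of `δ` (Hatcher 2002, §3.1); pattern
`groupCohomology.cocyclesMk`. [cite: Hatcher2002, §3.1] -/
abbrev cocyclesMk (φ : SingularSimplex X n → M)
    (h : (singularCochainComplex R M X).d n (n + 1) φ = 0) : cocycles R M X n :=
  (singularCochainComplex R M X).cyclesMk φ (n + 1) (by simp) h

variable (R M X n) in
/-- The inclusion `Zⁿ(X; M) ⟶ Cⁿ(X; M)` of cocycles into cochains (Hatcher 2002, §3.1). [cite: Hatcher2002, §3.1] -/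
abbrev iCocycles : cocycles R M X n ⟶ (singularCochainComplex R M X).X n :=
  (singularCochainComplex R M X).iCycles n

variable (R M X) in
/-- The map `Cⁱ(X; M) ⟶ Zʲ(X; M)` induced by the coboundary (Hatcher 2002, §3.1); pattern
`groupCohomology.toCocycles`. [cite: Hatcher2002, §3.1] -/
abbrev toCocycles (i j : ℕ) : (singularCochainComplex R M X).X i ⟶ cocycles R M X j :=
  (singularCochainComplex R M X).toCycles i j

/-- `iCocycles (cocyclesMk φ h) = φ` (Hatcher 2002, §3.1); pattern `groupCohomology.iCocycles_mk`. [cite: Hatcher2002, §3.1] -/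
@[simp]
lemma iCocycles_mk (φ : SingularSimplex X n → M)
    (h : (singularCochainComplex R M X).d n (n + 1) φ = 0) :
    iCocycles R M X n (cocyclesMk φ h) = φ :=
  (singularCochainComplex R M X).i_cyclesMk (i := n) φ (n + 1) (by simp) h

variable (R M) in
/-- The cochain map `f^♯ : C^•(Y; M) ⟶ C^•(X; M)` induced by a continuous map `f : X → Y`
(Hatcher 2002, §3.1): the alternating coface map complex functor applied to
`singularCochainCosimplicial.map R M f`. [cite: Hatcher2002, §3.1] -/
def map (f : C(X, Y)) : singularCochainComplex R M Y ⟶ singularCochainComplex R M X :=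
  (alternatingCofaceMapComplex _).map (singularCochainCosimplicial.map R M f)

/-- `f^♯ φ = φ ∘ f_♯`, i.e. `(f^♯ φ)(σ) = φ(f ∘ σ)` (Hatcher 2002, §3.1). [cite: Hatcher2002, §3.1] -/
@[simp]
lemma map_apply (f : C(X, Y)) (φ : (singularCochainComplex R M Y).X n)
    (σ : SingularSimplex X n) : (map R M f).f n φ σ = φ (σ.map f) :=
  rfl

variable (R M) in
/-- `𝟙^♯ = 𝟙` on singular cochains (Hatcher 2002, §3.1). [cite: Hatcher2002, §3.1] -/
@[simp]
lemma map_id : map R M (ContinuousMap.id X) = 𝟙 _ := by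
  ext n φ σ
  simp

variable (R M) in
/-- `(g ∘ f)^♯ = f^♯ ∘ g^♯` on singular cochains (contravariance; Hatcher 2002, §3.1). [cite: Hatcher2002, §3.1] -/
lemma map_comp (f : C(X, Y)) (g : C(Y, Z)) :
    map R M (g.comp f) = map R M g ≫ map R M f := by
  ext n φ σ
  simp [SingularSimplex.map_comp]

end singularCochainComplex

/-! ### Singular cohomology -/

variable (X) in
/-- The `n`-th singular cohomology `Hⁿ(X; M)` of `X` with coefficients in the `R`-module `M`, an
object of `ModuleCat.{max u v} R` (Hatcher 2002, §3.1): the `n`-th homology of the singular cochain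
complex `singularCochainComplex R M X`. [cite: Hatcher2002, §3.1] -/
def singularCohomology (n : ℕ) : ModuleCat.{max u v} R :=
  (singularCochainComplex R M X).homology n

namespace singularCohomology

variable (X) in
/-- The quotient map `Zⁿ(X; M) ⟶ Hⁿ(X; M)` from cocycles to cohomology classes (Hatcher 2002,
§3.1); pattern `groupCohomology.π`. [cite: Hatcher2002, §3.1] -/
abbrev π (n : ℕ) : singularCochainComplex.cocycles R M X n ⟶ singularCohomology R M X n :=
  (singularCochainComplex R M X).homologyπ n

end singularCohomology

/-- Every singular cohomology class is represented by a cocycle (Hatcher 2002, §3.1); pattern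
`groupCohomology_induction_on`. [cite: Hatcher2002, §3.1] -/
@[elab_as_elim]
theorem singularCohomology_induction_on {n : ℕ} {C : singularCohomology R M X n → Prop}
    (x : singularCohomology R M X n)
    (h : ∀ x : singularCochainComplex.cocycles R M X n, C (singularCohomology.π R M X n x)) :
    C x := by
  obtain ⟨y, rfl⟩ :=
    (ModuleCat.epi_iff_surjective ((singularCochainComplex R M X).homologyπ n)).1 inferInstance x
  exact h y

namespace singularCohomology

/-- The induced map `f^* : Hⁿ(Y; M) ⟶ Hⁿ(X; M)` of a continuous map `f : X → Y` (Hatcher 2002,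
§3.1, "Induced homomorphisms"); `HomologicalComplex.homologyMap` of `singularCochainComplex.map f`. [cite: Hatcher2002, §3.1  "Induced homomorphisms"] -/
abbrev map (f : C(X, Y)) (n : ℕ) : singularCohomology R M Y n ⟶ singularCohomology R M X n :=
  HomologicalComplex.homologyMap (singularCochainComplex.map R M f) n

/-- `𝟙^* = 𝟙` (Hatcher 2002, §3.1). [cite: Hatcher2002, §3.1] -/
@[simp]
lemma map_id (n : ℕ) : map R M (ContinuousMap.id X) n = 𝟙 _ := by
  change HomologicalComplex.homologyMap _ n = 𝟙 ((singularCochainComplex R M X).homology n)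
  rw [singularCochainComplex.map_id, HomologicalComplex.homologyMap_id]

/-- `(g ∘ f)^* = f^* ∘ g^*` (contravariance; Hatcher 2002, §3.1). [cite: Hatcher2002, §3.1] -/
@[reassoc]
lemma map_comp (f : C(X, Y)) (g : C(Y, Z)) (n : ℕ) :
    map R M (g.comp f) n = map R M g n ≫ map R M f n := by
  change HomologicalComplex.homologyMap _ n =
    HomologicalComplex.homologyMap _ n ≫ HomologicalComplex.homologyMap _ n
  rw [singularCochainComplex.map_comp, HomologicalComplex.homologyMap_comp]

/-- Homotopy invariance: homotopic maps induce the same map on singular cohomology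
(Hatcher 2002, §3.1, p. 201, dualising Thm. 2.10). [cite: Hatcher2002, §3.1  p. 201  dualising Thm. 2.10] -/
def map_eq_of_homotopic : Prop :=
  ∀ {f g : C(X, Y)}, f.Homotopic g → ∀ n : ℕ, map R M f n = map R M g n

/-- A homeomorphism induces an isomorphism `Hⁿ(Y; M) ≅ Hⁿ(X; M)` (Hatcher 2002, §3.1). [cite: Hatcher2002, §3.1] -/
@[simps]
def mapIso (e : X ≃ₜ Y) (n : ℕ) : singularCohomology R M Y n ≅ singularCohomology R M X n where
  hom := map R M e n
  inv := map R M e.symm n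
  hom_inv_id := by
    rw [← map_comp]
    exact (congrArg (map R M · n) (by ext x; exact e.apply_symm_apply x)).trans (map_id R M n)
  inv_hom_id := by
    rw [← map_comp]
    exact (congrArg (map R M · n) (by ext x; exact e.symm_apply_apply x)).trans (map_id R M n)

/-- A homotopy equivalence induces an isomorphism `Hⁿ(Y; M) ≅ Hⁿ(X; M)` (Hatcher 2002, §3.1,
dual of Cor. 2.11). The data (`hom := e^*`, `inv := (e⁻¹)^*`) is explicit.
Relies on the named fact `singularCohomology.map_eq_of_homotopic` (homotopy invariance), taken
as the explicit hypothesis `h` (needed on the self-maps of `X` and of `Y`, so quantified over all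
spaces). [cite: Hatcher2002, §3.1, dual of Cor. 2.11] -/
@[simps]
def isoOfHomotopyEquiv
    (h : ∀ {X Y : Type u} [TopologicalSpace X] [TopologicalSpace Y],
      map_eq_of_homotopic R M (X := X) (Y := Y))
    (e : ContinuousMap.HomotopyEquiv X Y) (n : ℕ) :
    singularCohomology R M Y n ≅ singularCohomology R M X n where
  hom := map R M e.toFun n
  inv := map R M e.invFun n
  hom_inv_id := by rw [← map_comp, h e.right_inv, map_id]
  inv_hom_id := by rw [← map_comp, h e.left_inv, map_id]

end singularCohomology

/-! ### Comparison with the `Hom`-dual of the singular chain complex -/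

namespace singularCochainComplex

variable {R M} {n : ℕ}

/-- The morphism `Cₙ(X; R) ⟶ M` obtained by extending a cochain `g : SingularSimplex X n → M`
linearly over the free module `Cₙ(X; R) = ⨁_σ R`, `r • σ ↦ r • g σ` (Hatcher 2002, §3.1,
"Cⁿ(X; G) = Hom(Cₙ(X), G)"). [cite: Hatcher2002, §3.1  "Cⁿ(X] -/
def XIsoFun (g : SingularSimplex X n → M) :
    (singularChainComplex R R X).X n ⟶ ModuleCat.of R (ULift.{u} M) :=
  Sigma.desc fun σ : SingularSimplex X n ↦ ModuleCat.ofHom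
    ((LinearMap.toSpanSingleton R (ULift.{u} M) (ULift.up (g σ))).comp
      ULift.moduleEquiv.toLinearMap)

/-- `XIsoFun g (r • σ) = r • g σ` (Hatcher 2002, §3.1). [cite: Hatcher2002, §3.1] -/
@[simp]
lemma XIsoFun_single (g : SingularSimplex X n → M) (σ : SingularSimplex X n) (r : R) :
    XIsoFun (R := R) g (singularChainComplex.single (R := R) σ r) = ULift.up (r • g σ) := by
  change (Sigma.ι (fun _ : SingularSimplex X n ↦ ModuleCat.of R (ULift.{u} R)) σ ≫
    XIsoFun (R := R) g) (ULift.up r) = _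
  rw [XIsoFun, Sigma.ι_desc]
  rfl

/-- The linear map underlying `XIso.hom`, `g ↦ XIsoFun g` (Hatcher 2002, §3.1). [cite: Hatcher2002, §3.1] -/
def XIsoHom : (SingularSimplex X n → M) →ₗ[R]
    ((singularChainComplex R R X).X n ⟶ ModuleCat.of R (ULift.{u} M)) where
  toFun g := XIsoFun (R := R) g
  map_add' g g' := by
    refine singularChainComplex.hom_ext fun σ r ↦ ?_
    change _ = XIsoFun (R := R) g (singularChainComplex.single (R := R) σ r) +
      XIsoFun (R := R) g' (singularChainComplex.single (R := R) σ r)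
    rw [XIsoFun_single, XIsoFun_single, XIsoFun_single, Pi.add_apply, smul_add]
    rfl
  map_smul' c g := by
    refine singularChainComplex.hom_ext fun σ r ↦ ?_
    change _ = c • XIsoFun (R := R) g (singularChainComplex.single (R := R) σ r)
    rw [XIsoFun_single, XIsoFun_single, Pi.smul_apply, smul_comm r c]
    rfl

/-- The linear map underlying `XIso.inv`: restrict `f : Cₙ(X; R) ⟶ M` to the basis of singular
simplices, `σ ↦ f (1 • σ)` (Hatcher 2002, §3.1). [cite: Hatcher2002, §3.1] -/
def XIsoInv : ((singularChainComplex R R X).X n ⟶ ModuleCat.of R (ULift.{u} M)) →ₗ[R]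
    (SingularSimplex X n → M) where
  toFun f σ := (f (singularChainComplex.single (R := R) σ (1 : R))).down
  map_add' _ _ := rfl
  map_smul' _ _ := rfl

variable (R M X n) in
/-- Levelwise identification of function-cochains with the `Hom`-dual of singular chains,
`Cⁿ(X; M) ≅ Hom_R(Cₙ(X; R), M)` (Hatcher 2002, §3.1, "Cⁿ(X; G) = Hom(Cₙ(X), G)"): a cochain
`g` extends linearly over the free module `Cₙ(X; R) = ⨁_σ R`; the inverse restricts to the basis
`σ ↦ 1 • σ`. [cite: Hatcher2002, §3.1  "Cⁿ(X] -/
def XIso : (singularCochainComplex R M X).X n ≅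
    ModuleCat.of R ((singularChainComplex R R X).X n ⟶ ModuleCat.of R (ULift.{u} M)) where
  hom := ModuleCat.ofHom XIsoHom
  inv := ModuleCat.ofHom XIsoInv
  hom_inv_id := by
    ext g σ
    change (XIsoFun (R := R) g (singularChainComplex.single (R := R) σ (1 : R))).down = g σ
    rw [XIsoFun_single, one_smul]
  inv_hom_id := by
    ext f : 2
    change XIsoFun (R := R) (fun σ ↦ (f (singularChainComplex.single (R := R) σ (1 : R))).down) = f
    refine singularChainComplex.hom_ext fun σ r ↦ ?_
    rw [XIsoFun_single]
    have h : singularChainComplex.single (R := R) σ r =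
        r • singularChainComplex.single (R := R) σ (1 : R) := by
      rw [← singularChainComplex.singleₗ_apply, ← singularChainComplex.singleₗ_apply, ← map_smul,
        smul_eq_mul, mul_one]
    rw [h, map_smul]
    rfl

variable (R M X) in
/-- The function-cochain complex is isomorphic to the `Hom`-dual `Hom_R(C_•(X; R), M)` of the
singular chain complex, Mathlib's `ChainComplex.linearYonedaObj` (Hatcher 2002, §3.1; the analogue
of `groupCohomology.inhomogeneousCochainsIso`). Levelwise this is `XIso`; compatibility with the
differentials is `d_apply` versus `singularChainComplex.d_single`. [cite: Hatcher2002, §3.1] -/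
def nonempty_iso_linearYonedaObj : Prop :=
  Nonempty (singularCochainComplex R M X ≅
      (singularChainComplex R R X).linearYonedaObj R (ModuleCat.of R (ULift.{u} M)))

end singularCochainComplex

/-! ### Sanity statements -/

/-- For a nonempty path-connected space, `H⁰(X; M) ≃ M` (Hatcher 2002, §3.1, Example following the
definition: `H⁰(X; G) = Hom(H₀(X), G)`, and Prop. 2.7). [cite: Hatcher2002, §3.1  Example following the definition] -/
def nonempty_singularCohomology_zero_equiv : Prop :=
  ∀ [PathConnectedSpace X],
    Nonempty (singularCohomology R M X 0 ≃ₗ[R] M)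

/-- The positive-degree singular cohomology of a point (a subsingleton space; for `X = ∅` all
cochain modules vanish) is zero (Hatcher 2002, §3.1, p. 199: `Hⁿ(pt; G) = 0` for `n > 0`). [cite: Hatcher2002, §3.1, p. 199] -/
def isZero_singularCohomology_of_subsingleton : Prop :=
  ∀ [Subsingleton X] {n : ℕ}, n ≠ 0 → IsZero (singularCohomology R M X n)

end Literature.AlgebraicTopology.SingularHomology
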